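import Mathlib.Analysis.CStarAlgebra.Matrix
import Mathlib.LinearAlgebra.Matrix.Kronecker
import HarnessLib

/-!
# The `ℓ²`-operator norm of a Kronecker product: `‖A ⊗ₖ B‖₂ = ‖A‖₂ ‖B‖₂`

Topic `Literature/Analysis/InnerProduct`; support file (all proved; no definitions; no named facts).

For rectangular matrices `A : Matrix m n 𝕜` and `B : Matrix p q 𝕜` over `𝕜 = ℝ` or `ℂ` (`RCLike 𝕜`),
with the `ℓ²`-OPERATOR norm on matrices (Mathlib's scoped instance `Matrix.Norms.L2Operator`,
`Matrix.l2_opNorm_def`: the norm of the induced map `EuclideanSpace 𝕜 n → EuclideanSpace 𝕜 m`), the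
Kronecker product `A ⊗ₖ B : Matrix (m × p) (n × q) 𝕜` (Mathlib `Matrix.kroneckerMap (· * ·)`, scoped
notation `⊗ₖ`) has norm exactly the product of the norms:

* `l2_opNorm_kronecker` — `‖A ⊗ₖ B‖ = ‖A‖ * ‖B‖` (Golub–Van Loan, *Matrix Computations* 4th ed.,
  §12.3.1 "Basic Properties": `‖B ⊗ C‖₂ = ‖B‖₂ · ‖C‖₂`, listed with
  `σ(B ⊗ C) = {βᵢ γⱼ : βᵢ ∈ σ(B), γⱼ ∈ σ(C)}` [corpus PDF p. 655]; the book states it over `ℝ`, here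
  `ℝ` or `ℂ`).  [cite: GolubVanLoan2013, §12.3.1]
* `l2_opNorm_kronecker_le` — the upper bound `‖A ⊗ₖ B‖ ≤ ‖A‖ * ‖B‖`, proved from the factorisation
  `A ⊗ₖ B = (A ⊗ₖ 1) * (1 ⊗ₖ B)` (`Matrix.mul_kronecker_mul`) and the two one-sided estimates
  `l2_opNorm_kronecker_one_le : ‖A ⊗ₖ 1‖ ≤ ‖A‖` (the factor acts column-wise by `A`) and
  `l2_opNorm_one_kronecker_le : ‖1 ⊗ₖ B‖ ≤ ‖B‖` (row-wise by `B`), each by summing the basic estimate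
  `‖A v‖ ≤ ‖A‖ ‖v‖` over the column / row slices of a vector indexed by a product (private
  helpers).
* `mul_norm_le_l2_opNorm_kronecker` — the lower bound `‖A‖ * ‖B‖ ≤ ‖A ⊗ₖ B‖`, from the action on
  elementary tensors `(x ⊗ y)(j, l) = x j * y l` (written as explicit lambdas, no definition is
  introduced): `(A ⊗ₖ B) (x ⊗ y) = (A x) ⊗ (B y)` (`kronecker_mulVec_tensorVec`) and
  `‖x ⊗ y‖ = ‖x‖ ‖y‖` (`norm_tensorVec`), followed by two applications of the bound principle
  `l2_opNorm_le_of_forall_norm_mulVec_le` (`‖A‖ ≤ C` as soon as `‖A v‖ ≤ C ‖v‖` for all `v`).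

Everything is stated for the `EuclideanSpace` vectors `WithLp.toLp 2 (M *ᵥ WithLp.ofLp v)` that
`Matrix.l2_opNorm_mulVec` speaks about.  The square, complex special case `‖U ⊗ₖ 1‖ ≤ ‖U‖` already
serves `Literature/Computability/QuantumComplexity/PlaceGateNorm` (gate placement) and two
`Summits/QuantumFields/QCD` cells (`‖1 ⊗ₖ A‖ ≤ ‖A‖` by reindexing); this file is the general,
rectangular, two-sided statement, for error budgets of layered tensor-network contractions (the
transfer operator of a doubled layer is a Kronecker product of the single-layer ones) and for any
norm bookkeeping on `V = R ⊗ₖ U`-type operators.  Everything here is textbook material.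

## References

* G. H. Golub, C. F. Van Loan, *Matrix Computations*, 4th ed., Johns Hopkins UP 2013, §2.3.1
  (2.3.2) (the subordinate `2`-norm) and §12.3.1 (Kronecker product: mixed-product rule,
  `σ(B ⊗ C)`, `‖B ⊗ C‖_F`, `‖B ⊗ C‖₂`) [GolubVanLoan2013; held as `book:golub2012-matrix-computations`,
  PDF pp. 78 and 654–655].
-/

noncomputable section

namespace Literature.Analysis.InnerProduct

open scoped Kronecker Matrix.Norms.L2Operator
open Matrix WithLp

variable {𝕜 : Type*} [RCLike 𝕜] {m n p q : Type*} [Fintype m] [Fintype n] [Fintype p] [Fintype q]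
  [DecidableEq m] [DecidableEq n] [DecidableEq p] [DecidableEq q]

/-! ## The bound principle and the basic estimate, in `toLp` form -/

omit [DecidableEq m] in
/-- The squared Euclidean norm of `toLp 2 v` is the sum of the squared norms of the entries of `v`.
[folklore] -/
private theorem norm_toLp_sq_eq_sum (v : m → 𝕜) :
    ‖(toLp 2 v : EuclideanSpace 𝕜 m)‖ ^ 2 = ∑ i, ‖v i‖ ^ 2 := by
  rw [EuclideanSpace.norm_sq_eq]

omit [DecidableEq m] in
/-- **Bound principle** for the `ℓ²`-operator norm of a (rectangular) matrix: if `‖A v‖ ≤ C ‖v‖` for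
every Euclidean vector `v` and `0 ≤ C`, then `‖A‖ ≤ C` — immediate from the `sup` characterisation
`‖A‖₂ = sup_{x ≠ 0} ‖A x‖₂ / ‖x‖₂` (Mathlib `ContinuousLinearMap.opNorm_le_bound`).
[cite: GolubVanLoan2013, §2.3.1 (2.3.2)] -/
theorem l2_opNorm_le_of_forall_norm_mulVec_le (A : Matrix m n 𝕜) {C : ℝ} (hC : 0 ≤ C)
    (h : ∀ v : EuclideanSpace 𝕜 n, ‖(toLp 2 (A *ᵥ ofLp v) : EuclideanSpace 𝕜 m)‖ ≤ C * ‖v‖) :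
    ‖A‖ ≤ C := by
  rw [Matrix.l2_opNorm_def]
  exact ContinuousLinearMap.opNorm_le_bound _ hC fun v => h v

omit [DecidableEq m] in
/-- The basic estimate `‖A v‖ ≤ ‖A‖ ‖v‖` (the other face of the `sup` characterisation (2.3.2);
Mathlib `Matrix.l2_opNorm_mulVec`, restated with `toLp`). [cite: GolubVanLoan2013, §2.3.1 (2.3.2)] -/
theorem norm_toLp_mulVec_le (A : Matrix m n 𝕜) (v : EuclideanSpace 𝕜 n) :
    ‖(toLp 2 (A *ᵥ ofLp v) : EuclideanSpace 𝕜 m)‖ ≤ ‖A‖ * ‖v‖ :=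
  Matrix.l2_opNorm_mulVec A v

/-! ## Slicing a vector indexed by a product -/

omit [DecidableEq m] [DecidableEq p] in
/-- Column slices: for `w` indexed by `m × p`, `‖w‖² = Σ_k ‖w(·, k)‖²`. [folklore] -/
private theorem norm_sq_eq_sum_norm_sq_cols (w : EuclideanSpace 𝕜 (m × p)) :
    ‖w‖ ^ 2 = ∑ k : p, ‖(toLp 2 (fun i : m => ofLp w (i, k)) : EuclideanSpace 𝕜 m)‖ ^ 2 := by
  rw [EuclideanSpace.norm_sq_eq, Fintype.sum_prod_type, Finset.sum_comm]
  refine Finset.sum_congr rfl fun k _ => ?_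
  rw [norm_toLp_sq_eq_sum]

omit [DecidableEq m] [DecidableEq p] in
/-- Row slices: for `w` indexed by `m × p`, `‖w‖² = Σ_i ‖w(i, ·)‖²`. [folklore] -/
private theorem norm_sq_eq_sum_norm_sq_rows (w : EuclideanSpace 𝕜 (m × p)) :
    ‖w‖ ^ 2 = ∑ i : m, ‖(toLp 2 (fun k : p => ofLp w (i, k)) : EuclideanSpace 𝕜 p)‖ ^ 2 := by
  rw [EuclideanSpace.norm_sq_eq, Fintype.sum_prod_type]
  refine Finset.sum_congr rfl fun i _ => ?_
  rw [norm_toLp_sq_eq_sum]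

/-! ## The one-sided factors `A ⊗ₖ 1` and `1 ⊗ₖ B` -/

omit [Fintype m] [DecidableEq m] [DecidableEq n] in
/-- `A ⊗ₖ 1` acts column-wise by `A`: `((A ⊗ₖ 1) w)(i, k) = (A w(·, k))(i)`. [folklore] -/
private theorem kronecker_one_mulVec_apply' (A : Matrix m n 𝕜) (w : n × p → 𝕜) (i : m) (k : p) :
    ((A ⊗ₖ (1 : Matrix p p 𝕜)) *ᵥ w) (i, k) = (A *ᵥ fun j => w (j, k)) i := by
  simp only [Matrix.mulVec, dotProduct, Matrix.kroneckerMap_apply, Fintype.sum_prod_type,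
    Matrix.one_apply, mul_ite, mul_one, mul_zero, ite_mul, zero_mul]
  refine Finset.sum_congr rfl fun j _ => ?_
  rw [Finset.sum_ite_eq]
  simp

omit [Fintype p] [DecidableEq p] [DecidableEq q] in
/-- `1 ⊗ₖ B` acts row-wise by `B`: `((1 ⊗ₖ B) w)(j, k) = (B w(j, ·))(k)`. [folklore] -/
private theorem one_kronecker_mulVec_apply' (B : Matrix p q 𝕜) (w : n × q → 𝕜) (j : n) (k : p) :
    (((1 : Matrix n n 𝕜) ⊗ₖ B) *ᵥ w) (j, k) = (B *ᵥ fun l => w (j, l)) k := by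
  simp only [Matrix.mulVec, dotProduct, Matrix.kroneckerMap_apply, Fintype.sum_prod_type,
    Matrix.one_apply, ite_mul, one_mul, zero_mul]
  rw [Finset.sum_eq_single j]
  · simp
  · intro j' _ hj'
    simp [Ne.symm hj']
  · intro hj
    exact absurd (Finset.mem_univ j) hj

omit [DecidableEq m] in
/-- **`‖A ⊗ₖ 1‖ ≤ ‖A‖`** for a rectangular `A` and an identity of any size (the case `C = I` of
`‖B ⊗ C‖₂ = ‖B‖₂ ‖C‖₂`, as an inequality so that the empty index type is allowed).
[cite: GolubVanLoan2013, §12.3.1] -/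
theorem l2_opNorm_kronecker_one_le (A : Matrix m n 𝕜) :
    ‖A ⊗ₖ (1 : Matrix p p 𝕜)‖ ≤ ‖A‖ := by
  refine l2_opNorm_le_of_forall_norm_mulVec_le _ (norm_nonneg A) fun w => ?_
  have hsq : ‖(toLp 2 ((A ⊗ₖ (1 : Matrix p p 𝕜)) *ᵥ ofLp w) : EuclideanSpace 𝕜 (m × p))‖ ^ 2 ≤
      (‖A‖ * ‖w‖) ^ 2 := by
    rw [norm_sq_eq_sum_norm_sq_cols, mul_pow, norm_sq_eq_sum_norm_sq_cols w, Finset.mul_sum]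
    refine Finset.sum_le_sum fun k _ => ?_
    have h := norm_toLp_mulVec_le A (toLp 2 fun j => ofLp w (j, k))
    have h' : (fun i : m => ofLp (toLp 2 ((A ⊗ₖ (1 : Matrix p p 𝕜)) *ᵥ ofLp w)) (i, k)) =
        A *ᵥ fun j => ofLp w (j, k) := by
      funext i
      rw [ofLp_toLp]
      exact kronecker_one_mulVec_apply' A (ofLp w) i k
    rw [h', ← mul_pow]
    exact pow_le_pow_left₀ (norm_nonneg _) h 2
  exact (pow_le_pow_iff_left₀ (norm_nonneg _) (mul_nonneg (norm_nonneg _) (norm_nonneg _))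
    two_ne_zero).1 hsq

omit [DecidableEq p] in
/-- **`‖1 ⊗ₖ B‖ ≤ ‖B‖`** for a rectangular `B` and an identity of any size (the case `B = I` of
`‖B ⊗ C‖₂ = ‖B‖₂ ‖C‖₂`, as an inequality so that the empty index type is allowed).
[cite: GolubVanLoan2013, §12.3.1] -/
theorem l2_opNorm_one_kronecker_le (B : Matrix p q 𝕜) :
    ‖(1 : Matrix n n 𝕜) ⊗ₖ B‖ ≤ ‖B‖ := by
  refine l2_opNorm_le_of_forall_norm_mulVec_le _ (norm_nonneg B) fun w => ?_
  have hsq : ‖(toLp 2 (((1 : Matrix n n 𝕜) ⊗ₖ B) *ᵥ ofLp w) : EuclideanSpace 𝕜 (n × p))‖ ^ 2 ≤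
      (‖B‖ * ‖w‖) ^ 2 := by
    rw [norm_sq_eq_sum_norm_sq_rows, mul_pow, norm_sq_eq_sum_norm_sq_rows w, Finset.mul_sum]
    refine Finset.sum_le_sum fun j _ => ?_
    have h := norm_toLp_mulVec_le B (toLp 2 fun l => ofLp w (j, l))
    have h' : (fun k : p => ofLp (toLp 2 (((1 : Matrix n n 𝕜) ⊗ₖ B) *ᵥ ofLp w)) (j, k)) =
        B *ᵥ fun l => ofLp w (j, l) := by
      funext k
      rw [ofLp_toLp]
      exact one_kronecker_mulVec_apply' B (ofLp w) j k
    rw [h', ← mul_pow]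
    exact pow_le_pow_left₀ (norm_nonneg _) h 2
  exact (pow_le_pow_iff_left₀ (norm_nonneg _) (mul_nonneg (norm_nonneg _) (norm_nonneg _))
    two_ne_zero).1 hsq

/-! ## The upper bound -/

omit [DecidableEq m] [DecidableEq p] in
/-- **`‖A ⊗ₖ B‖ ≤ ‖A‖ ‖B‖`** (sub-multiplicativity of the `ℓ²`-operator norm under Kronecker
products), via `A ⊗ₖ B = (A ⊗ₖ 1) * (1 ⊗ₖ B)`. [cite: GolubVanLoan2013, §12.3.1] -/
theorem l2_opNorm_kronecker_le (A : Matrix m n 𝕜) (B : Matrix p q 𝕜) :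
    ‖A ⊗ₖ B‖ ≤ ‖A‖ * ‖B‖ := by
  classical
  have hfac : A ⊗ₖ B = (A ⊗ₖ (1 : Matrix p p 𝕜)) * ((1 : Matrix n n 𝕜) ⊗ₖ B) := by
    rw [← Matrix.mul_kronecker_mul, Matrix.mul_one, Matrix.one_mul]
  rw [hfac]
  exact (Matrix.l2_opNorm_mul _ _).trans
    (mul_le_mul (l2_opNorm_kronecker_one_le A) (l2_opNorm_one_kronecker_le B) (norm_nonneg _)
      (norm_nonneg _))

/-! ## Elementary tensors and the lower bound -/

omit [DecidableEq n] [DecidableEq q] in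
/-- `‖x ⊗ y‖ = ‖x‖ ‖y‖` for Euclidean vectors, the elementary tensor being the coordinate vector
`(j, l) ↦ x j * y l` on the product index type (the one-column case of
`‖B ⊗ C‖_F = ‖B‖_F ‖C‖_F`). [cite: GolubVanLoan2013, §12.3.1] -/
theorem norm_tensorVec (x : EuclideanSpace 𝕜 n) (y : EuclideanSpace 𝕜 q) :
    ‖(toLp 2 (fun jl : n × q => ofLp x jl.1 * ofLp y jl.2) : EuclideanSpace 𝕜 (n × q))‖ =
      ‖x‖ * ‖y‖ := by
  have hsq : ‖(toLp 2 (fun jl : n × q => ofLp x jl.1 * ofLp y jl.2) : EuclideanSpace 𝕜 (n × q))‖ ^ 2 =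
      (‖x‖ * ‖y‖) ^ 2 := by
    rw [norm_toLp_sq_eq_sum, mul_pow, EuclideanSpace.norm_sq_eq x, EuclideanSpace.norm_sq_eq y,
      Finset.sum_mul_sum, Fintype.sum_prod_type]
    refine Finset.sum_congr rfl fun j _ => Finset.sum_congr rfl fun l _ => ?_
    rw [norm_mul, mul_pow]
  exact (pow_left_inj₀ (norm_nonneg _) (mul_nonneg (norm_nonneg _) (norm_nonneg _))
    two_ne_zero).1 hsq

omit [Fintype m] [Fintype p] [DecidableEq m] [DecidableEq n] [DecidableEq p] [DecidableEq q] in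
/-- `(A ⊗ₖ B)(x ⊗ y) = (A x) ⊗ (B y)` on elementary tensors `(j, l) ↦ x j * y l` (the one-column
case of the mixed-product rule `(B ⊗ C)(D ⊗ F) = BD ⊗ CF`). [cite: GolubVanLoan2013, §12.3.1] -/
theorem kronecker_mulVec_tensorVec (A : Matrix m n 𝕜) (B : Matrix p q 𝕜) (x : n → 𝕜) (y : q → 𝕜) :
    ((A ⊗ₖ B) *ᵥ fun jl : n × q => x jl.1 * y jl.2) =
      fun ik : m × p => (A *ᵥ x) ik.1 * (B *ᵥ y) ik.2 := by
  funext ik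
  simp only [Matrix.mulVec, dotProduct, Matrix.kroneckerMap_apply, Fintype.sum_prod_type,
    Finset.sum_mul_sum]
  refine Finset.sum_congr rfl fun j _ => Finset.sum_congr rfl fun l _ => ?_
  ring

omit [DecidableEq m] [DecidableEq p] in
/-- On elementary tensors the Kronecker product multiplies norms:
`‖A x‖ ‖B y‖ ≤ ‖A ⊗ₖ B‖ ‖x‖ ‖y‖`. [folklore] -/
private theorem norm_mulVec_mul_norm_mulVec_le (A : Matrix m n 𝕜) (B : Matrix p q 𝕜)
    (x : EuclideanSpace 𝕜 n) (y : EuclideanSpace 𝕜 q) :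
    ‖(toLp 2 (A *ᵥ ofLp x) : EuclideanSpace 𝕜 m)‖ * ‖(toLp 2 (B *ᵥ ofLp y) : EuclideanSpace 𝕜 p)‖ ≤
      ‖A ⊗ₖ B‖ * (‖x‖ * ‖y‖) := by
  have h1 := norm_tensorVec (toLp 2 (A *ᵥ ofLp x) : EuclideanSpace 𝕜 m)
    (toLp 2 (B *ᵥ ofLp y) : EuclideanSpace 𝕜 p)
  rw [ofLp_toLp, ofLp_toLp, ← kronecker_mulVec_tensorVec] at h1
  rw [← h1, ← norm_tensorVec x y]
  have h2 := norm_toLp_mulVec_le (A ⊗ₖ B) (toLp 2 fun jl : n × q => ofLp x jl.1 * ofLp y jl.2)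
  rwa [ofLp_toLp] at h2

omit [DecidableEq m] [DecidableEq p] in
/-- **`‖A‖ ‖B‖ ≤ ‖A ⊗ₖ B‖`.** [cite: GolubVanLoan2013, §12.3.1] -/
theorem mul_norm_le_l2_opNorm_kronecker (A : Matrix m n 𝕜) (B : Matrix p q 𝕜) :
    ‖A‖ * ‖B‖ ≤ ‖A ⊗ₖ B‖ := by
  set K := ‖A ⊗ₖ B‖ with hK
  have hK0 : 0 ≤ K := norm_nonneg _
  -- Step 1: for every `y`, `‖A‖ ‖B y‖ ≤ K ‖y‖`.
  have step1 : ∀ y : EuclideanSpace 𝕜 q,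
      ‖A‖ * ‖(toLp 2 (B *ᵥ ofLp y) : EuclideanSpace 𝕜 p)‖ ≤ K * ‖y‖ := by
    intro y
    by_cases hBy : ‖(toLp 2 (B *ᵥ ofLp y) : EuclideanSpace 𝕜 p)‖ = 0
    · rw [hBy, mul_zero]
      exact mul_nonneg hK0 (norm_nonneg _)
    have hBy_pos : 0 < ‖(toLp 2 (B *ᵥ ofLp y) : EuclideanSpace 𝕜 p)‖ :=
      lt_of_le_of_ne (norm_nonneg _) (Ne.symm hBy)
    have hA : ‖A‖ ≤ K * ‖y‖ / ‖(toLp 2 (B *ᵥ ofLp y) : EuclideanSpace 𝕜 p)‖ := by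
      refine l2_opNorm_le_of_forall_norm_mulVec_le A
        (div_nonneg (mul_nonneg hK0 (norm_nonneg _)) (norm_nonneg _)) fun x => ?_
      rw [div_mul_eq_mul_div, le_div_iff₀ hBy_pos]
      calc ‖(toLp 2 (A *ᵥ ofLp x) : EuclideanSpace 𝕜 m)‖ *
            ‖(toLp 2 (B *ᵥ ofLp y) : EuclideanSpace 𝕜 p)‖
          ≤ K * (‖x‖ * ‖y‖) := norm_mulVec_mul_norm_mulVec_le A B x y
        _ = K * ‖y‖ * ‖x‖ := by ring
    rwa [le_div_iff₀ hBy_pos] at hA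
  -- Step 2: divide by `‖A‖` (or conclude trivially when `‖A‖ = 0`).
  by_cases hA0 : ‖A‖ = 0
  · rw [hA0, zero_mul]
    exact hK0
  have hA_pos : 0 < ‖A‖ := lt_of_le_of_ne (norm_nonneg _) (Ne.symm hA0)
  have hB : ‖B‖ ≤ K / ‖A‖ := by
    refine l2_opNorm_le_of_forall_norm_mulVec_le B (div_nonneg hK0 (norm_nonneg _)) fun y => ?_
    rw [div_mul_eq_mul_div, le_div_iff₀ hA_pos, mul_comm]
    exact step1 y
  rw [le_div_iff₀ hA_pos, mul_comm] at hB
  exact hB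

/-! ## The identity -/

omit [DecidableEq m] [DecidableEq p] in
/-- **The `ℓ²`-operator norm of a Kronecker product is the product of the norms**:
`‖A ⊗ₖ B‖ = ‖A‖ * ‖B‖` for rectangular `A`, `B` over `ℝ` or `ℂ` (Golub–Van Loan §12.3.1,
"`‖B ⊗ C‖₂ = ‖B‖₂‖C‖₂`"). [cite: GolubVanLoan2013, §12.3.1] -/
theorem l2_opNorm_kronecker (A : Matrix m n 𝕜) (B : Matrix p q 𝕜) :
    ‖A ⊗ₖ B‖ = ‖A‖ * ‖B‖ :=
  le_antisymm (l2_opNorm_kronecker_le A B) (mul_norm_le_l2_opNorm_kronecker A B)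

omit [DecidableEq m] [DecidableEq p] in
/-- `‖A ⊗ₖ B‖₊ = ‖A‖₊ * ‖B‖₊` (the `NNReal` form of `l2_opNorm_kronecker`).
[cite: GolubVanLoan2013, §12.3.1] -/
theorem l2_opNNNorm_kronecker (A : Matrix m n 𝕜) (B : Matrix p q 𝕜) :
    ‖A ⊗ₖ B‖₊ = ‖A‖₊ * ‖B‖₊ :=
  NNReal.eq <| by simpa using l2_opNorm_kronecker A B

omit [DecidableEq m] in
/-- With square identity factors the one-sided estimates are equalities:
`‖A ⊗ₖ 1‖ = ‖A‖` whenever the identity is on a non-empty index type.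
[cite: GolubVanLoan2013, §12.3.1] -/
theorem l2_opNorm_kronecker_one [Nonempty p] (A : Matrix m n 𝕜) :
    ‖A ⊗ₖ (1 : Matrix p p 𝕜)‖ = ‖A‖ := by
  rw [l2_opNorm_kronecker, norm_one, mul_one]

omit [DecidableEq p] in
/-- `‖1 ⊗ₖ B‖ = ‖B‖` whenever the identity is on a non-empty index type.
[cite: GolubVanLoan2013, §12.3.1] -/
theorem l2_opNorm_one_kronecker [Nonempty n] (B : Matrix p q 𝕜) :
    ‖(1 : Matrix n n 𝕜) ⊗ₖ B‖ = ‖B‖ := by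
  rw [l2_opNorm_kronecker, norm_one, one_mul]

end Literature.Analysis.InnerProduct
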